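import Literature.NumberTheory.EllipticCurves.BSDSelmerSmithCaseIICoefficientsProofs
import Literature.NumberTheory.EllipticCurves.BSDSelmerSmithDecomposition
import Literature.NumberTheory.EllipticCurves.BSDSelmerSmithRootNumberDensityProofs
import Literature.NumberTheory.EllipticCurves.BSDSelmerSmithIsogenyProofs
import Literature.NumberTheory.EllipticCurves.ComplexMultiplicationTwistIsogenyProofs
import Literature.NumberTheory.EllipticCurves.Curve49A1Points
import HarnessLib

/-!
# Smith's Assumption 1.1 for the `ℚ(√−7)`-curves: `X₀(49)` and its twists are in Case II

Cell `bsd-goldfeld` (planner seat, generation 2), file 6: a PRINT-STRENGTH upgrade of the Smith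
input of the cell's target. Theorems only — no named fact, no axiom, no definition.

In files 3–5 (`GoldfeldGoodTwistsX049`, `…HalfHalf`) Smith's distribution theorem for
`E₀ = X₀(49) = 49a1` enters either as the hypothesis `hS : smith_selmerCorank_density cm7`
(A. Smith, arXiv:2503.17619, Thm. 1.1 — a 2025 preprint) or, in
`bsdRank_and_goldfeld_twists_of_X049_of_smith_inputs`, through the tree's general assembly
`smith_selmerCorank_density_holds_of`, which needs BOTH the published part ([Smi22a] = A. Smith,
*The distribution of `ℓ^∞`-Selmer groups in degree `ℓ` twist families I*, Thm. 1.2 under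
Assumption 1.1) AND the preprint-only Thm. 1.17 (Cases IV/V of arXiv:2503.17619) plus Monsky and
Modularity. This file shows that for the `ℚ(√−7)`-curves the published part alone suffices:

* `smithCaseII_twoTorsionNF_seven` — for every `d ≠ 0` the curve
  `E^{(d)} : y² = x³ + 21d·x² + 112d²·x` (the quadratic twist by `d` of the model
  `E : y² = x³ + 21x² + 112x = x·(x² + 21x + 112)` of `49a1`, `j = −3375`) is in Smith's CASE II
  (arXiv:2503.17619, Def. 1.6), i.e. satisfies [Smi22a] Assumption 1.1 (2) — by the literature
  seat's decidable criterion `smithCaseII_of_not_isSquare` (`BSDSelmerSmithCaseIICoefficientsProofs`: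
  `y² = x(x² + ax + b)` is in Case II iff `a² − 4b`, `b`, `b(a² − 4b)` are non-squares in `ℚ`;
  Smith II, Ex. 1.2): here `a² − 4b = −7d² < 0`, `b = 112d² = 7·(4d)²` and `b(a² − 4b) = −784d⁴ < 0`,
  and `7 ∉ ℚ²`. Concretely: `E^{(d)}(ℚ)[2] ≅ ℤ/2ℤ`, the `2`-isogeny
  `φ : E^{(d)} → E₀^{(d)} : Y² = X³ − 42d·X² − 7d²·X` (`twoIsogenyCodomain_twoTorsionNF_seven`) is
  not balanced (`ℚ(E^{(d)}[2]) = ℚ(√−7) ≠ ℚ(√7) = ℚ(E₀^{(d)}[2])`), and `E₀^{(d)}(ℚ)[2] ≇ (ℤ/2ℤ)²`.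
* `smith_selmerCorank_density_of_j_eq_neg3375` / `…_of_j_eq_16581375` — hence [Smi22a] Thm. 1.2
  (`h22 : smith2022_selmerCorank_distribution`, PUBLISHED: J. Amer. Math. Soc.) ALONE gives Smith's
  distribution statement `smith_selmerCorank_density W` for every elliptic `W / ℚ` with
  `j(W) = −3375` (these are the `ℚ`-models of the quadratic twists of `49a1`, Silverman X.5.4) and,
  along the `2`-isogeny (`smith_selmerCorank_density_of_isogeny'`, the source's own Case III
  reduction), for every `W` with `j(W) = 16581375 = 255³` (the twists of `49a2`); in particular
  for `cm7 = 49a1` itself, `smith_selmerCorank_density_of_j_eq_neg3375 h22 cm7 j_cm7 :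
  smith_selmerCorank_density cm7` — no Thm. 1.17, no Monsky, no Modularity. (The cell's literature
  seat files the direct Case-II certificate for the model `cm7` on the Literature side,
  `BSDSelmerSmithCaseIICoefficientsProofs`: `smithCaseII_cm7`, `smith_selmerCorank_density_cm7_of_smith2022`.)

References: A. Smith, arXiv:2503.17619 (2025), Def. 1.6, §1.1 [arXiv250317619]; A. Smith, *The
distribution of `ℓ^∞`-Selmer groups in degree `ℓ` twist families I*, arXiv:2207.05674, J. Amer.
Math. Soc. (2025), Assumption 1.1 and Thm. 1.2 [Smith2022SelmerTwistI]; J. H. Silverman, *AEC*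
(2009), III.4 Example 4.5, X.5 Prop. 5.4 [SilvermanAEC2009]; J. E. Cremona, *Algorithms for Modular
Elliptic Curves* (labels `49a1`, `49a2`) [Cremona2006].
-/

set_option linter.dupNamespace false
set_option autoImplicit false

noncomputable section

open scoped Classical

open Filter Topology WeierstrassCurve Literature.NumberTheory.EllipticCurves

namespace Summit.BirchSwinnertonDyer.BirchSwinnertonDyer.Theorems.GoldfeldGoodTwists

/-! ## §1 The twists of `49a1` in `2`-torsion normal form -/

/-- `E^{(d)} : y² = x³ + 21d·x² + 112d²·x` is elliptic for `d ≠ 0`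
(`Δ = 16·(112d²)²·((21d)² − 4·112d²) = −1404928·d⁶`). [folklore] -/
theorem isElliptic_twoTorsionNF_seven (d : ℚ) (hd : d ≠ 0) :
    (⟨0, 21 * d, 0, 112 * d ^ 2, 0⟩ : WeierstrassCurve ℚ).IsElliptic := by
  refine ⟨isUnit_iff_ne_zero.mpr ?_⟩
  rw [Δ_of_isTwoTorsionNF]
  show (16 : ℚ) * (112 * d ^ 2) ^ 2 * ((21 * d) ^ 2 - 4 * (112 * d ^ 2)) ≠ 0
  have e : (16 : ℚ) * (112 * d ^ 2) ^ 2 * ((21 * d) ^ 2 - 4 * (112 * d ^ 2)) =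
      -(1404928 * d ^ 6) := by ring
  rw [e, neg_ne_zero]
  positivity

/-- `j(y² = x³ + 21x² + 112x) = 1680³/(−1404928) = −3375 = j(49a1)`.
[cite: Cremona2006, Table 1 (Cremona label 49a1)] -/
theorem j_twoTorsionNF_seven_one [(⟨0, 21, 0, 112, 0⟩ : WeierstrassCurve ℚ).IsElliptic] :
    (⟨0, 21, 0, 112, 0⟩ : WeierstrassCurve ℚ).j = -3375 := by
  rw [j_eq_c₄_pow_div]
  norm_num [WeierstrassCurve.Δ, WeierstrassCurve.c₄, WeierstrassCurve.b₂, WeierstrassCurve.b₄,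
    WeierstrassCurve.b₆, WeierstrassCurve.b₈]

/-- The quadratic twist of `y² = x³ + 21x² + 112x` by `d` is `y² = x³ + 21d·x² + 112d²·x`
(`b₂ = 84`, `b₄ = 224`, `b₆ = 0`). [folklore] -/
theorem quadraticTwist_twoTorsionNF_seven_one (d : ℚ) :
    (⟨0, 21, 0, 112, 0⟩ : WeierstrassCurve ℚ).quadraticTwist d = ⟨0, 21 * d, 0, 112 * d ^ 2, 0⟩ := by
  ext
  · rfl
  · rw [quadraticTwist_a₂]; norm_num [WeierstrassCurve.b₂]; ring
  · rfl
  · rw [quadraticTwist_a₄]; norm_num [WeierstrassCurve.b₄]; ring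
  · rw [quadraticTwist_a₆]; norm_num [WeierstrassCurve.b₆]

/-- The `2`-isogenous curve of `E^{(d)} : y² = x³ + 21d·x² + 112d²·x` is
`E₀^{(d)} : Y² = X³ − 42d·X² − 7d²·X` (Silverman, *AEC*, III.4.5: `Y² = X³ − 2aX² + (a² − 4b)X`).
[cite: SilvermanAEC2009, III.4 Example 4.5] -/
theorem twoIsogenyCodomain_twoTorsionNF_seven (d : ℚ) :
    (⟨0, 21 * d, 0, 112 * d ^ 2, 0⟩ : WeierstrassCurve ℚ).twoIsogenyCodomain =
      ⟨0, -(42 * d), 0, -(7 * d ^ 2), 0⟩ := by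
  ext
  · rfl
  · rw [twoIsogenyCodomain_a₂]; show -2 * (21 * d) = -(42 * d); ring
  · rfl
  · rw [twoIsogenyCodomain_a₄]; show (21 * d) ^ 2 - 4 * (112 * d ^ 2) = -(7 * d ^ 2); ring
  · rfl

/-! ## §2 Case II -/

/-- **`X₀(49)` and all its quadratic twists are in Smith's Case II.** For `d ≠ 0`,
`E^{(d)} : y² = x³ + 21d·x² + 112d²·x = x(x² + ax + b)` with `a = 21d`, `b = 112d²` satisfies the
criterion `smithCaseII_of_not_isSquare` (Smith II, Ex. 1.2): `a² − 4b = −7d² < 0`,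
`b = 7·(4d)²` with `7 ∉ ℚ²`, `b(a² − 4b) = −784d⁴ < 0` are all non-squares in `ℚ` — i.e.
`E^{(d)}(ℚ)[2] ≅ ℤ/2ℤ` (`ℚ(E^{(d)}[2]) = ℚ(√−7)`), the `2`-isogeny with kernel `⟨(0,0)⟩` onto
`E₀^{(d)} : Y² = X³ − 42dX² − 7d²X` is not balanced (`ℚ(E₀^{(d)}[2]) = ℚ(√7) ≠ ℚ(√−7)`), and
`E₀^{(d)}(ℚ)[2] ≇ (ℤ/2ℤ)²`. This is Smith, arXiv:2503.17619, Def. 1.6, Case II, equivalently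
[Smi22a] Assumption 1.1 (2). [cite: arXiv250317619, Def. 1.6]
[cite: Smith2022SelmerTwistI, Assumption 1.1] [cite: Smith2026SelmerTwistII, Ex. 1.2] -/
theorem smithCaseII_twoTorsionNF_seven (d : ℚ) (hd : d ≠ 0) :
    smithCaseII (⟨0, 21 * d, 0, 112 * d ^ 2, 0⟩ : WeierstrassCurve ℚ) := by
  have hd2 : 0 < d ^ 2 := by positivity
  have h4 : (4 : ℚ) * d ≠ 0 := mul_ne_zero (by norm_num) hd
  refine smithCaseII_of_not_isSquare (21 * d) (112 * d ^ 2) ?_ ?_ ?_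
  -- `a² − 4b = −7d² < 0`; `b = 112d² = 7·(4d)²` with `7 ∉ ℚ²`; `b(a² − 4b) = −784d⁴ < 0`
  all_goals
    rintro ⟨r, hr⟩
    first
    | nlinarith [mul_self_nonneg r, pow_pos hd2 2]
    | have h7 : IsSquare (7 : ℚ) := ⟨r / (4 * d), by
        rw [div_mul_div_comm, eq_div_iff (mul_ne_zero h4 h4)]
        linear_combination hr⟩
      norm_num at h7

/-! ## §3 Smith's distribution theorem for the `ℚ(√−7)`-curves from [Smi22a] Thm. 1.2 alone -/

/-- [Smi22a] Thm. 1.2 gives Smith's distribution statement for every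
`E^{(d)} : y² = x³ + 21d·x² + 112d²·x`, `d ≠ 0` (Case II ⟹ Assumption 1.1).
[cite: Smith2022SelmerTwistI, Thm. 1.2 with Assumption 1.1] -/
theorem smith_selmerCorank_density_twoTorsionNF_seven (h22 : smith2022_selmerCorank_distribution)
    (d : ℚ) (hd : d ≠ 0) :
    smith_selmerCorank_density (⟨0, 21 * d, 0, 112 * d ^ 2, 0⟩ : WeierstrassCurve ℚ) :=
  haveI := isElliptic_twoTorsionNF_seven d hd
  smith_selmerCorank_density_of_smi22a_printed h22 _
    (smi22aAssumption_of_smithCaseII _ (smithCaseII_twoTorsionNF_seven d hd))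

/-- The same for the `2`-isogenous curves `E₀^{(d)} : Y² = X³ − 42d·X² − 7d²·X` (Smith's Case III
reduction: Thm. 1.1 is isogeny-invariant, `smith_selmerCorank_density_of_isogeny'`).
[cite: Smith2022SelmerTwistI, Thm. 1.2] [cite: arXiv250317619, §1.1 (Case III reduction)] -/
theorem smith_selmerCorank_density_twoTorsionNF_seven_codomain
    (h22 : smith2022_selmerCorank_distribution) (d : ℚ) (hd : d ≠ 0) :
    smith_selmerCorank_density (⟨0, -(42 * d), 0, -(7 * d ^ 2), 0⟩ : WeierstrassCurve ℚ) := by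
  haveI := isElliptic_twoTorsionNF_seven d hd
  have h := smith_selmerCorank_density_of_isogeny'
    (⟨0, 21 * d, 0, 112 * d ^ 2, 0⟩ : WeierstrassCurve ℚ).twoIsogeny
    (smith_selmerCorank_density_twoTorsionNF_seven h22 d hd)
  rwa [twoIsogenyCodomain_twoTorsionNF_seven] at h

/-- **Smith's distribution theorem for every elliptic curve with `j = −3375`, from [Smi22a]
Thm. 1.2 alone.** Such a `W` is `ℚ`-isomorphic to a quadratic twist `E^{(d)}` of
`E : y² = x³ + 21x² + 112x` (same `j ≠ 0, 1728`, Silverman X.5.4: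
`exists_variableChange_eq_quadraticTwist_of_j_eq'`), which is in Case II, and the statement is
model-independent (`smith_selmerCorank_density_smul_iff`).
[cite: Smith2022SelmerTwistI, Thm. 1.2 with Assumption 1.1] [cite: SilvermanAEC2009, X.5 Prop. 5.4] -/
theorem smith_selmerCorank_density_of_j_eq_neg3375 (h22 : smith2022_selmerCorank_distribution)
    (W : WeierstrassCurve ℚ) [W.IsElliptic] (hj : W.j = -3375) : smith_selmerCorank_density W := by
  haveI := Curve49A1.isElliptic
  obtain ⟨d, hd, C, hC⟩ := exists_variableChange_eq_quadraticTwist_of_j_eq'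
    (E := (⟨0, 21, 0, 112, 0⟩ : WeierstrassCurve ℚ)) (hj.trans j_twoTorsionNF_seven_one.symm)
    (by rw [hj]; norm_num) (by rw [hj]; norm_num)
  rw [quadraticTwist_twoTorsionNF_seven_one] at hC
  have h := smith_selmerCorank_density_twoTorsionNF_seven h22 d hd
  rw [← hC] at h
  exact (smith_selmerCorank_density_smul_iff W C).mp h

/-- `E₀ : Y² = X³ − 42X² − 7X` (a model of `49a2`: `c₄ = 28560`, `Δ = 1404928 = 2¹²·7³`) is
elliptic. [folklore] -/
theorem isElliptic_twoTorsionNF_seven_codomain_one :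
    (⟨0, -42, 0, -7, 0⟩ : WeierstrassCurve ℚ).IsElliptic :=
  ⟨isUnit_iff_ne_zero.mpr (by norm_num [WeierstrassCurve.Δ, WeierstrassCurve.b₂,
    WeierstrassCurve.b₄, WeierstrassCurve.b₆, WeierstrassCurve.b₈])⟩

/-- `j(Y² = X³ − 42X² − 7X) = 28560³/1404928 = 16581375 = 255³ = j(49a2)`.
[cite: Cremona2006, Table 1 (Cremona label 49a2)] -/
theorem j_twoTorsionNF_seven_codomain_one [(⟨0, -42, 0, -7, 0⟩ : WeierstrassCurve ℚ).IsElliptic] :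
    (⟨0, -42, 0, -7, 0⟩ : WeierstrassCurve ℚ).j = 16581375 := by
  rw [j_eq_c₄_pow_div]
  norm_num [WeierstrassCurve.Δ, WeierstrassCurve.c₄, WeierstrassCurve.b₂, WeierstrassCurve.b₄,
    WeierstrassCurve.b₆, WeierstrassCurve.b₈]

/-- The quadratic twist of `Y² = X³ − 42X² − 7X` by `d` is `Y² = X³ − 42d·X² − 7d²·X`
(`b₂ = −168`, `b₄ = −14`, `b₆ = 0`). [folklore] -/
theorem quadraticTwist_twoTorsionNF_seven_codomain_one (d : ℚ) :
    (⟨0, -42, 0, -7, 0⟩ : WeierstrassCurve ℚ).quadraticTwist d =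
      ⟨0, -(42 * d), 0, -(7 * d ^ 2), 0⟩ := by
  ext
  · rfl
  · rw [quadraticTwist_a₂]; norm_num [WeierstrassCurve.b₂]; ring
  · rfl
  · rw [quadraticTwist_a₄]; norm_num [WeierstrassCurve.b₄]; ring
  · rw [quadraticTwist_a₆]; norm_num [WeierstrassCurve.b₆]

/-- **Smith's distribution theorem for every elliptic curve with `j = 16581375 = 255³`, from
[Smi22a] Thm. 1.2 alone** (the twists of `49a2`, `2`-isogenous to those of `49a1`).
[cite: Smith2022SelmerTwistI, Thm. 1.2] [cite: arXiv250317619, §1.1 (Case III reduction)]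
[cite: SilvermanAEC2009, X.5 Prop. 5.4] -/
theorem smith_selmerCorank_density_of_j_eq_16581375 (h22 : smith2022_selmerCorank_distribution)
    (W : WeierstrassCurve ℚ) [W.IsElliptic] (hj : W.j = 16581375) :
    smith_selmerCorank_density W := by
  haveI := isElliptic_twoTorsionNF_seven_codomain_one
  obtain ⟨d, hd, C, hC⟩ := exists_variableChange_eq_quadraticTwist_of_j_eq'
    (E := (⟨0, -42, 0, -7, 0⟩ : WeierstrassCurve ℚ)) (hj.trans j_twoTorsionNF_seven_codomain_one.symm)
    (by rw [hj]; norm_num) (by rw [hj]; norm_num)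
  rw [quadraticTwist_twoTorsionNF_seven_codomain_one] at hC
  have h := smith_selmerCorank_density_twoTorsionNF_seven_codomain h22 d hd
  rw [← hC] at h
  exact (smith_selmerCorank_density_smul_iff W C).mp h

end Summit.BirchSwinnertonDyer.BirchSwinnertonDyer.Theorems.GoldfeldGoodTwists

end
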